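import Summits.Schanuel.Schanuel.Theorems.RootDecomp1BDefectFloorDefs
import Summits.Schanuel.Schanuel.Theorems.RootDecomp1BTameFlagCore
import Literature.NumberTheory.Transcendental.PeriodsWave0

/-!
# RootDecomp1BDefectFloorCellsKit (part 1 of 2 of RootDecomp1BDefectFloorCells: the polar-generator toolkit modDeg / phaseDeg, submodularity, sides inequality; part 2 = the cells) — DECIDED CELLS of the defect floor (lens 4 gen 9, node `DefectFloor`): the Lindemann–Weierstrass family (β | e^γ) at every length, its certified wild direction, the Nesterenko flag (π | Γ(1/4))

Extracted mechanically (dependency closure) from HOME/decomp-schanuel-lens-4/g9/DefectFloor.lean (critic-screened node,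
round 9 of RootDecomp1B); identical twins of landed `RootDecomp1BFedFlag{Defs,Core}` / `RootDecomp1BTameFlag{Defs,Core,Steps}`
declarations are `open`ed by name, not restated; sorry-free; standard axioms.
-/

open Complex IntermediateField
open Literature.NumberTheory.Transcendental (trdeg_adjoin_le_of_le isAlgebraic_adjoin_over_algebraAdjoin nesterenko)

namespace Summit.Schanuel.Schanuel.Theorems.RootDecomp1BDefectFloorCells

set_option linter.dupNamespace false

open Summit.Schanuel.Schanuel.Theorems.RootDecomp1BFedFlagCore (KleinIH polarDeg baseField polarField trdeg_adjoin_lt_aleph0 polarDeg_lt_aleph0 coe_mem_adjoin_of_mem_span coe_mem_polarField exp_coe_mem_polarField exp_coe_mul_I_mem_polarField)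
open Summit.Schanuel.Schanuel.Theorems.RootDecomp1BTameFlagCore (baseDeg pairDeg IsWild LastTame trdeg_adjoin_le_cardinalMk isAlgebraic_I init_mem_span)
open Summit.Schanuel.Schanuel.Theorems.RootDecomp1BDefectFloorDefs (SharpRelativeLindemannAt TameDefectZeroAt WildSharpDefectZeroAt)

section

variable {m : ℕ}

/-- a(r) = trdeg_ℚ ℚ(r, e^r), the MODULUS side. -/
noncomputable def modDeg {m : ℕ} (r : Fin m → ℝ) : Cardinal :=
  Algebra.trdeg ℚ ↥(IntermediateField.adjoin ℚ
    (Set.range (fun j => ((r j : ℝ) : ℂ)) ∪ Set.range (Complex.exp ∘ fun j => ((r j : ℝ) : ℂ))))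

/-- b(r) = trdeg_ℚ ℚ(i r, e^{i r}), the PHASE side. -/
noncomputable def phaseDeg {m : ℕ} (r : Fin m → ℝ) : Cardinal :=
  Algebra.trdeg ℚ ↥(IntermediateField.adjoin ℚ
    (Set.range (fun j => ((r j : ℝ) : ℂ) * Complex.I) ∪
      Set.range (Complex.exp ∘ fun j => ((r j : ℝ) : ℂ) * Complex.I)))

/-- The flagship triple (π, e^π, Γ(1/4)) of gen 5 (base rank 3 PROVED: Nesterenko) — first open cell of the residual. -/
noncomputable def piExpPiGamma : Fin 3 → ℝ := ![Real.pi, Real.exp Real.pi, Real.Gamma (1 / 4)]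

/-- The NESTERENKO FLAG (π | Γ(1/4)) … -/
noncomputable def piGamma : Fin 2 → ℝ := ![Real.pi, Real.Gamma (1 / 4)]

/-- … and its re-basing (Γ(1/4) | π) (last coordinate fed). -/
noncomputable def gammaPi : Fin 2 → ℝ := ![Real.Gamma (1 / 4), Real.pi]

/-- Monotonicity of transcendence degree under inclusion of generators. [folklore] -/
private theorem trdeg_adjoin_mono {S T : Set ℂ} (h : S ⊆ T) :
    Algebra.trdeg ℚ ↥(IntermediateField.adjoin ℚ S) ≤ Algebra.trdeg ℚ ↥(IntermediateField.adjoin ℚ T) :=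
  trdeg_le_of_injective (IntermediateField.inclusion (IntermediateField.adjoin.mono ℚ S T h))
    (IntermediateField.inclusion_injective _)

/-- The range of an appended tuple is the union of the ranges (the inclusion we need). -/
theorem range_append_subset {α : Type*} {m n : ℕ} (f : Fin m → α) (g : Fin n → α) :
    Set.range (Fin.append f g) ⊆ Set.range f ∪ Set.range g := by
  rintro _ ⟨k, rfl⟩
  induction k using Fin.addCases with
  | left j => exact Or.inl ⟨j, by simp only [Fin.append_left]⟩
  | right j => exact Or.inr ⟨j, by simp only [Fin.append_right]⟩

/-- The Schanuel generators of the polar tuple lie in `C ∪ A ∪ B` with `C = {r} ∪ {i r}` (the base,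
`i r` being algebraic over `ℚ(r)`), `A = {e^r}` (modulus exponentials), `B = {e^{i r}}` (phase exponentials). -/
theorem polar_gens_subset {m : ℕ} (r : Fin m → ℝ) :
    Set.range (Fin.append (fun j => ((r j : ℝ) : ℂ)) (fun j => ((r j : ℝ) : ℂ) * Complex.I)) ∪
        Set.range (Complex.exp ∘ Fin.append (fun j => ((r j : ℝ) : ℂ)) (fun j => ((r j : ℝ) : ℂ) * Complex.I)) ⊆
      (Set.range (fun j => ((r j : ℝ) : ℂ)) ∪ Set.range (fun j => ((r j : ℝ) : ℂ) * Complex.I)) ∪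
          Set.range (Complex.exp ∘ fun j => ((r j : ℝ) : ℂ)) ∪
        Set.range (Complex.exp ∘ fun j => ((r j : ℝ) : ℂ) * Complex.I) := by
  refine Set.union_subset ?_ ?_
  · exact (range_append_subset _ _).trans (Set.subset_union_left.trans Set.subset_union_left)
  · rw [Set.range_comp]
    refine (Set.image_mono (range_append_subset _ _)).trans ?_
    rw [Set.image_union, ← Set.range_comp, ← Set.range_comp]
    exact Set.union_subset (Set.subset_union_right.trans Set.subset_union_left) Set.subset_union_right

/-- The polar tuple `(r, i r)` of a `ℚ`-free real tuple is `ℚ`-free. -/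
theorem linearIndependent_polar {m : ℕ} {r : Fin m → ℝ} (hr : LinearIndependent ℚ r) :
    LinearIndependent ℚ
      (Fin.append (fun j => ((r j : ℝ) : ℂ)) (fun j => ((r j : ℝ) : ℂ) * Complex.I)) := by
  rw [Fintype.linearIndependent_iff] at hr ⊢
  intro c hc
  rw [Fin.sum_univ_add] at hc
  simp only [Fin.append_left, Fin.append_right] at hc
  have hre : ((∑ i : Fin m, c (Fin.castAdd m i) • r i : ℝ) : ℂ) =
      ∑ i : Fin m, c (Fin.castAdd m i) • ((r i : ℝ) : ℂ) := by
    rw [Complex.ofReal_sum]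
    refine Finset.sum_congr rfl fun j _ => ?_
    rw [Rat.smul_def, Rat.smul_def, Complex.ofReal_mul, Complex.ofReal_ratCast]
  have him : ((∑ i : Fin m, c (Fin.natAdd m i) • r i : ℝ) : ℂ) * Complex.I =
      ∑ i : Fin m, c (Fin.natAdd m i) • (((r i : ℝ) : ℂ) * Complex.I) := by
    rw [Complex.ofReal_sum, Finset.sum_mul]
    refine Finset.sum_congr rfl fun j _ => ?_
    rw [Rat.smul_def, Rat.smul_def, Complex.ofReal_mul, Complex.ofReal_ratCast, mul_assoc]
  rw [← hre, ← him] at hc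
  have h0 := congrArg Complex.re hc
  have h1 := congrArg Complex.im hc
  simp only [Complex.add_re, Complex.ofReal_re, Complex.mul_re, Complex.I_re, Complex.I_im,
    Complex.ofReal_im, Complex.add_im, Complex.mul_im, Complex.zero_re, Complex.zero_im,
    mul_zero, mul_one, sub_zero, zero_add, add_zero] at h0 h1
  have hc1 : ∀ i : Fin m, c (Fin.castAdd m i) = 0 :=
    hr (fun i => c (Fin.castAdd m i)) (by simpa using h0)
  have hc2 : ∀ i : Fin m, c (Fin.natAdd m i) = 0 :=
    hr (fun i => c (Fin.natAdd m i)) (by simpa using h1)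
  intro k
  refine Fin.addCases (fun i => ?_) (fun i => ?_) k
  · exact hc1 i
  · exact hc2 i

set_option synthInstance.maxHeartbeats 200000 in
/-- Tower law for generated fields: `trdeg K(S ∪ T) = trdeg K(S) + trdeg_{K(S)} K(S)(T)`
(`trdeg_add_eq`, `adjoin_adjoin_left`). [folklore; lens-2 `DefectLattice.trdeg_adjoin_union_eq`] -/
private theorem trdeg_adjoin_union_eq {K E : Type*} [Field K] [Field E] [Algebra K E] (S T : Set E) :
    Algebra.trdeg K (adjoin K (S ∪ T)) =
      Algebra.trdeg K (adjoin K S) + Algebra.trdeg (adjoin K S) (adjoin (adjoin K S) T) := by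
  have htower := trdeg_add_eq K (adjoin K S) (A := adjoin (adjoin K S) T)
  have heq : Algebra.trdeg K (adjoin (adjoin K S) T) = Algebra.trdeg K (adjoin K (S ∪ T)) := by
    rw [← (equivOfEq (adjoin_adjoin_left K S T)).trdeg_eq]
    rfl
  rw [← heq, htower]

set_option synthInstance.maxHeartbeats 200000 in
/-- SUBMODULARITY of `S ↦ trdeg K(S)`: `trdeg K(C ∪ A ∪ B) + trdeg K(C) ≤ trdeg K(C ∪ A) + trdeg K(C ∪ B)`
(tower law twice + base change `trdeg_adjoin_le_of_le`). [folklore: the algebraic matroid;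
lens-2 `DefectLattice.trdeg_submodular`] -/
theorem trdeg_submodular {K E : Type*} [Field K] [Field E] [Algebra K E] (C A B : Set E) :
    Algebra.trdeg K (adjoin K (C ∪ A ∪ B)) + Algebra.trdeg K (adjoin K C) ≤
      Algebra.trdeg K (adjoin K (C ∪ A)) + Algebra.trdeg K (adjoin K (C ∪ B)) := by
  have h1 := trdeg_adjoin_union_eq (K := K) (C ∪ A) B
  have h3 := trdeg_adjoin_union_eq (K := K) C B
  have h2 : Algebra.trdeg (adjoin K (C ∪ A)) (adjoin (adjoin K (C ∪ A)) B) ≤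
      Algebra.trdeg (adjoin K C) (adjoin (adjoin K C) B) :=
    trdeg_adjoin_le_of_le (adjoin.mono K _ _ Set.subset_union_left) B
  rw [h1, h3]
  calc Algebra.trdeg K (adjoin K (C ∪ A)) +
        Algebra.trdeg (adjoin K (C ∪ A)) (adjoin (adjoin K (C ∪ A)) B) +
        Algebra.trdeg K (adjoin K C)
      ≤ Algebra.trdeg K (adjoin K (C ∪ A)) +
        Algebra.trdeg (adjoin K C) (adjoin (adjoin K C) B) +
        Algebra.trdeg K (adjoin K C) := add_le_add (add_le_add le_rfl h2) le_rfl
    _ = Algebra.trdeg K (adjoin K (C ∪ A)) +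
        (Algebra.trdeg K (adjoin K C) + Algebra.trdeg (adjoin K C) (adjoin (adjoin K C) B)) := by
        rw [add_assoc, add_comm (Algebra.trdeg (adjoin K C) _)]

set_option synthInstance.maxHeartbeats 200000 in
/-- `T` algebraic over `K` ⟹ `trdeg_ℚ ℚ(T) ≤ trdeg_ℚ K`. [folklore; lens-2 `DefectLattice.trdeg_adjoin_le_of_isAlgebraic`] -/
private theorem trdeg_adjoin_le_of_isAlgebraic (K : IntermediateField ℚ ℂ) {T : Set ℂ}
    (hT : ∀ x ∈ T, IsAlgebraic K x) :
    Algebra.trdeg ℚ ↥(adjoin ℚ T) ≤ Algebra.trdeg ℚ ↥K := by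
  have hmono : Algebra.trdeg ℚ ↥(adjoin ℚ T) ≤ Algebra.trdeg ℚ ↥(adjoin ℚ ((K : Set ℂ) ∪ T)) :=
    trdeg_adjoin_mono Set.subset_union_right
  refine hmono.trans (le_of_eq ?_)
  haveI : Algebra.IsAlgebraic K (adjoin K T) :=
    isAlgebraic_adjoin fun x hx => (hT x hx).isIntegral
  have h := trdeg_add_eq ℚ K (A := adjoin K T)
  rw [trdeg_eq_zero (R := K) (A := adjoin K T), add_zero] at h
  have e := (equivOfEq (restrictScalars_adjoin ℚ K T)).symm.trdeg_eq
  calc Algebra.trdeg ℚ ↥(adjoin ℚ ((K : Set ℂ) ∪ T))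
      = Algebra.trdeg ℚ ↥((adjoin K T).restrictScalars ℚ) := e
    _ = Algebra.trdeg ℚ ↥(adjoin K T) := rfl
    _ = Algebra.trdeg ℚ ↥K := h.symm

/-- Elements of the generating set are algebraic over the generated field. [lens-2] -/
private theorem isAlgebraic_of_mem_gens {S : Set ℂ} {x : ℂ} (hx : x ∈ S) :
    IsAlgebraic ↥(adjoin ℚ S) x := by
  have hx' : x ∈ adjoin ℚ S := subset_adjoin ℚ S hx
  exact isAlgebraic_algebraMap (⟨x, hx'⟩ : ↥(adjoin ℚ S))

/-- `i` is algebraic over `ℚ` … -/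
private theorem isAlgebraic_I_rat : IsAlgebraic ℚ Complex.I :=
  IsAlgebraic.of_pow two_pos (by rw [Complex.I_sq]; exact isAlgebraic_one.neg)

/-- `k` algebraically independent elements of `L` give `k ≤ trdeg_ℚ L`. [folklore] -/
theorem natCast_le_trdeg_of_algebraicIndependent {k : ℕ} {L : IntermediateField ℚ ℂ}
    {z : Fin k → ℂ} (hz : AlgebraicIndependent ℚ z) (hmem : ∀ i, z i ∈ L) :
    (k : Cardinal) ≤ Algebra.trdeg ℚ ↥L := by
  let z' : Fin k → ↥L := fun i => ⟨z i, hmem i⟩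
  have hz' : AlgebraicIndependent ℚ z' := AlgebraicIndependent.of_comp L.val hz
  simpa using hz'.cardinalMk_le_trdeg

set_option synthInstance.maxHeartbeats 200000 in
/-- SIDE BOUND (S): `trdeg ℚ(f, e^f) ≤ trdeg ℚ(f) + m` for any `m`-tuple `f` (tower law; the top
storey is generated by the `m` exponentials). -/
theorem trdeg_gens_le_base_add {m : ℕ} (f : Fin m → ℂ) :
    Algebra.trdeg ℚ ↥(adjoin ℚ (Set.range f ∪ Set.range (Complex.exp ∘ f))) ≤
      Algebra.trdeg ℚ ↥(adjoin ℚ (Set.range f)) + (m : Cardinal) := by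
  have htop : Algebra.trdeg ↥(adjoin ℚ (Set.range f))
        ↥(adjoin (↥(adjoin ℚ (Set.range f))) (Set.range (Complex.exp ∘ f))) ≤ (m : Cardinal) :=
    calc Algebra.trdeg ↥(adjoin ℚ (Set.range f))
          ↥(adjoin (↥(adjoin ℚ (Set.range f))) (Set.range (Complex.exp ∘ f)))
        ≤ Cardinal.mk (Set.range (Complex.exp ∘ f)) := trdeg_adjoin_le_cardinalMk _
      _ ≤ Cardinal.mk (Fin m) := Cardinal.mk_range_le
      _ = (m : Cardinal) := Cardinal.mk_fin m
  calc Algebra.trdeg ℚ ↥(adjoin ℚ (Set.range f ∪ Set.range (Complex.exp ∘ f)))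
      = Algebra.trdeg ℚ ↥(adjoin ℚ (Set.range f)) + Algebra.trdeg ↥(adjoin ℚ (Set.range f))
          ↥(adjoin (↥(adjoin ℚ (Set.range f))) (Set.range (Complex.exp ∘ f))) :=
        trdeg_adjoin_union_eq (K := ℚ) _ _
    _ ≤ Algebra.trdeg ℚ ↥(adjoin ℚ (Set.range f)) + (m : Cardinal) := add_le_add le_rfl htop

/-- The base of the phase side is algebraic over the base of the modulus side:
`trdeg ℚ(i r) ≤ trdeg ℚ(r)`. -/
theorem trdeg_imagBase_le {m : ℕ} (r : Fin m → ℝ) :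
    Algebra.trdeg ℚ ↥(adjoin ℚ (Set.range (fun j => ((r j : ℝ) : ℂ) * Complex.I))) ≤
      Algebra.trdeg ℚ ↥(adjoin ℚ (Set.range (fun j => ((r j : ℝ) : ℂ)))) := by
  refine trdeg_adjoin_le_of_isAlgebraic _ ?_
  rintro _ ⟨j, rfl⟩
  exact (isAlgebraic_of_mem_gens (S := Set.range (fun j => ((r j : ℝ) : ℂ))) ⟨j, rfl⟩).mul
    (isAlgebraic_I _)

set_option synthInstance.maxHeartbeats 200000 in
/-- ENTANGLEMENT INEQUALITY (E): `t + ρ ≤ a + b` — the joint transcendence degree plus the algebraic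
rank of the base is at most the sum of the two side transcendence degrees.  Submodularity of `trdeg`
for `C = {r, i r}`, `A = {e^r}`, `B = {e^{i r}}`, plus: `ℚ(C, A)` is algebraic over the modulus field
`ℚ(r, e^r)` and `ℚ(C, B)` over the phase field `ℚ(i r, e^{i r})` (as `i` is algebraic). -/
theorem polar_trdeg_add_rank_le_sides {m : ℕ} (r : Fin m → ℝ) :
    Algebra.trdeg ℚ ↥(IntermediateField.adjoin ℚ
        (Set.range (Fin.append (fun j => ((r j : ℝ) : ℂ)) (fun j => ((r j : ℝ) : ℂ) * Complex.I)) ∪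
          Set.range (Complex.exp ∘ Fin.append (fun j => ((r j : ℝ) : ℂ)) (fun j => ((r j : ℝ) : ℂ) * Complex.I)))) +
      Algebra.trdeg ℚ ↥(IntermediateField.adjoin ℚ (Set.range (fun j => ((r j : ℝ) : ℂ)))) ≤
    Algebra.trdeg ℚ ↥(IntermediateField.adjoin ℚ
        (Set.range (fun j => ((r j : ℝ) : ℂ)) ∪ Set.range (Complex.exp ∘ fun j => ((r j : ℝ) : ℂ)))) +
      Algebra.trdeg ℚ ↥(IntermediateField.adjoin ℚ
        (Set.range (fun j => ((r j : ℝ) : ℂ) * Complex.I) ∪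
          Set.range (Complex.exp ∘ fun j => ((r j : ℝ) : ℂ) * Complex.I))) := by
  have hsub := trdeg_submodular (K := ℚ)
    (Set.range (fun j => ((r j : ℝ) : ℂ)) ∪ Set.range (fun j => ((r j : ℝ) : ℂ) * Complex.I))
    (Set.range (Complex.exp ∘ fun j => ((r j : ℝ) : ℂ)))
    (Set.range (Complex.exp ∘ fun j => ((r j : ℝ) : ℂ) * Complex.I))
  have h1 := trdeg_adjoin_mono (polar_gens_subset r)
  have h2 : Algebra.trdeg ℚ ↥(adjoin ℚ (Set.range (fun j => ((r j : ℝ) : ℂ)))) ≤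
      Algebra.trdeg ℚ ↥(adjoin ℚ
        (Set.range (fun j => ((r j : ℝ) : ℂ)) ∪ Set.range (fun j => ((r j : ℝ) : ℂ) * Complex.I))) :=
    trdeg_adjoin_mono Set.subset_union_left
  have h3 : Algebra.trdeg ℚ ↥(adjoin ℚ
        (Set.range (fun j => ((r j : ℝ) : ℂ)) ∪ Set.range (fun j => ((r j : ℝ) : ℂ) * Complex.I) ∪
          Set.range (Complex.exp ∘ fun j => ((r j : ℝ) : ℂ)))) ≤
      Algebra.trdeg ℚ ↥(adjoin ℚ
        (Set.range (fun j => ((r j : ℝ) : ℂ)) ∪ Set.range (Complex.exp ∘ fun j => ((r j : ℝ) : ℂ)))) := by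
    refine trdeg_adjoin_le_of_isAlgebraic _ ?_
    rintro x ((⟨j, rfl⟩ | ⟨j, rfl⟩) | ⟨j, rfl⟩)
    · exact isAlgebraic_of_mem_gens (Or.inl ⟨j, rfl⟩)
    · exact (isAlgebraic_of_mem_gens
          (S := Set.range (fun j => ((r j : ℝ) : ℂ)) ∪ Set.range (Complex.exp ∘ fun j => ((r j : ℝ) : ℂ)))
          (Or.inl ⟨j, rfl⟩)).mul (isAlgebraic_I _)
    · exact isAlgebraic_of_mem_gens (Or.inr ⟨j, rfl⟩)
  have h4 : Algebra.trdeg ℚ ↥(adjoin ℚ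
        (Set.range (fun j => ((r j : ℝ) : ℂ)) ∪ Set.range (fun j => ((r j : ℝ) : ℂ) * Complex.I) ∪
          Set.range (Complex.exp ∘ fun j => ((r j : ℝ) : ℂ) * Complex.I))) ≤
      Algebra.trdeg ℚ ↥(adjoin ℚ
        (Set.range (fun j => ((r j : ℝ) : ℂ) * Complex.I) ∪
          Set.range (Complex.exp ∘ fun j => ((r j : ℝ) : ℂ) * Complex.I))) := by
    refine trdeg_adjoin_le_of_isAlgebraic _ ?_
    rintro x ((⟨j, rfl⟩ | ⟨j, rfl⟩) | ⟨j, rfl⟩)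
    · have h := ((isAlgebraic_of_mem_gens
          (S := Set.range (fun j => ((r j : ℝ) : ℂ) * Complex.I) ∪
            Set.range (Complex.exp ∘ fun j => ((r j : ℝ) : ℂ) * Complex.I))
          (Or.inl ⟨j, rfl⟩)).mul (isAlgebraic_I _)).neg
      simpa only [mul_assoc, Complex.I_mul_I, mul_neg, mul_one, neg_neg] using h
    · exact isAlgebraic_of_mem_gens (Or.inl ⟨j, rfl⟩)
    · exact isAlgebraic_of_mem_gens (Or.inr ⟨j, rfl⟩)
  calc _ ≤ _ := add_le_add h1 h2
    _ ≤ _ := hsub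
    _ ≤ _ := add_le_add h3 h4

/-- The modulus degree `a(r)` is finite. -/
theorem modDeg_lt_aleph0 {m : ℕ} (r : Fin m → ℝ) : modDeg r < Cardinal.aleph0 :=
  trdeg_adjoin_lt_aleph0 ((Set.finite_range _).union (Set.finite_range _))

/-- The phase degree `b(r)` is finite. -/
theorem phaseDeg_lt_aleph0 {m : ℕ} (r : Fin m → ℝ) : phaseDeg r < Cardinal.aleph0 :=
  trdeg_adjoin_lt_aleph0 ((Set.finite_range _).union (Set.finite_range _))

/-- (S) for the modulus side: a ≤ ρ + m. -/
theorem modDeg_le_baseDeg_add {m : ℕ} (r : Fin m → ℝ) : modDeg r ≤ baseDeg r + (m : Cardinal) :=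
  trdeg_gens_le_base_add _

/-- (S) for the phase side: b ≤ ρ + m. -/
theorem phaseDeg_le_baseDeg_add {m : ℕ} (r : Fin m → ℝ) : phaseDeg r ≤ baseDeg r + (m : Cardinal) :=
  (trdeg_gens_le_base_add _).trans (add_le_add (trdeg_imagBase_le r) le_rfl)

/-- (E): t + ρ ≤ a + b. -/
theorem polarDeg_add_baseDeg_le {m : ℕ} (r : Fin m → ℝ) : polarDeg r + baseDeg r ≤ modDeg r + phaseDeg r :=
  polar_trdeg_add_rank_le_sides r

/-- A base all of whose coordinates but (at most) one are ALGEBRAIC has rank ≤ 1 — e.g. (1, π), (1, log 2),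
(1, e), (√2, π), (α, log β). -/
theorem baseDeg_le_one_of_algebraic_off_one {m : ℕ} (r : Fin m → ℝ) (j₀ : Fin m)
    (halg : ∀ j, j ≠ j₀ → IsAlgebraic ℚ ((r j : ℝ) : ℂ)) : baseDeg r ≤ 1 := by
  unfold baseDeg
  have hK : ∀ x ∈ Set.range (fun j => ((r j : ℝ) : ℂ)),
      IsAlgebraic ↥(adjoin ℚ ({((r j₀ : ℝ) : ℂ)} : Set ℂ)) x := by
    rintro _ ⟨j, rfl⟩
    by_cases hj : j = j₀
    · subst hj
      exact isAlgebraic_of_mem_gens (Set.mem_singleton _)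
    · exact (halg j hj).tower_top _
  refine (trdeg_adjoin_le_of_isAlgebraic _ hK).trans ?_
  refine (trdeg_adjoin_le_cardinalMk (F := ℚ) _).trans ?_
  rw [Cardinal.mk_singleton]

end

end Summit.Schanuel.Schanuel.Theorems.RootDecomp1BDefectFloorCells
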